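import Summits.AtomisticToContinuum.HydrodynamicLimit.Theorems.EquilibriumClampedCollisionalWindowLD.Negative.FinalIneq

/-!
# The final inequality, part 2, and the witness objects of the refutation (helper file of the refutation of `EquilibriumClampedCollisionalWindowLD`, stmt-AtomisticToContinuum-13733; see `Cruxes/EquilibriumClampedCollisionalWindowLD/Disproof.lean` and the evidence WITNESS.md; no Theses declaration is asserted positively; refuter-cdisprove-stmt-AtomisticToContinuum-13733-0)
-/

noncomputable section

open Real
open scoped InnerProductSpace

namespace Summit.AtomisticToContinuum.HydrodynamicLimit.Theorems

namespace EquilibriumClampedCollisionalWindowLDNegative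

section FinalIneq

open MeasureTheory Literature.Analysis.FluidPDE Literature.Analysis.FunctionSpaces Literature.MathematicalPhysics.KineticTheory

namespace LatW

/-- The number of slots is `(l n)³`. -/
theorem card_slot (l n t : ℕ) : Fintype.card (LatW l n t).Slot = (l * n) ^ 3 := by
  show Fintype.card (Fin (LatW l n t).M × Fin (LatW l n t).n × Fin (LatW l n t).n) = (l * n) ^ 3
  rw [Fintype.card_prod, Fintype.card_prod, Fintype.card_fin, Fintype.card_fin, M_eq, n_eq]; ring

/-- The constant `K₀ = (4π/3)² (2π)^{-3/2} (4/5)⁶ ≥ 1/10`. [folklore] -/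
theorem K0_ge : (1 / 10 : ℝ) ≤ (Real.pi * 4 / 3) ^ 2 * (2 * Real.pi) ^ (-(3 : ℝ) / 2) * (4 / 5 : ℝ) ^ 6 := by
  have hπ3 := Real.pi_gt_three
  have hπ := Real.pi_lt_d2
  have h1 : (16 : ℝ) ≤ (Real.pi * 4 / 3) ^ 2 := by nlinarith
  have h2 : (1 / 40 : ℝ) ≤ (2 * Real.pi) ^ (-(3 : ℝ) / 2) := by
    have h2π : (1 : ℝ) ≤ 2 * Real.pi := by linarith
    calc (1 / 40 : ℝ) ≤ ((2 * Real.pi) ^ 2)⁻¹ := by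
          rw [le_inv_comm₀ (by norm_num) (by positivity)]; nlinarith
      _ = (2 * Real.pi) ^ (-(2 : ℝ)) := by
          rw [Real.rpow_neg (by positivity), ← Real.rpow_natCast]; norm_num
      _ ≤ (2 * Real.pi) ^ (-(3 : ℝ) / 2) := Real.rpow_le_rpow_of_exponent_le h2π (by norm_num)
  have h3 : (1 / 4 : ℝ) ≤ (4 / 5 : ℝ) ^ 6 := by norm_num
  calc (1 / 10 : ℝ) = 16 * (1 / 40) * (1 / 4) := by norm_num
    _ ≤ _ := by
        refine mul_le_mul (mul_le_mul h1 h2 (by norm_num) (by positivity)) h3 (by norm_num) (by positivity)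

/-- `e^{-9/2} ≤ 1/10`. -/
theorem exp_neg_le : Real.exp (-(9 / 2 : ℝ)) ≤ 1 / 10 := by
  rw [Real.exp_neg, inv_eq_one_div, div_le_div_iff_of_pos_left one_pos (Real.exp_pos _) (by norm_num)]
  have h := Real.add_one_le_exp (3 / 2 : ℝ)
  have e : Real.exp (9 / 2 : ℝ) = Real.exp (3 / 2) ^ 3 := by rw [← Real.exp_nat_mul]; norm_num
  have h3 : (5 / 2 : ℝ) ^ 3 ≤ Real.exp (3 / 2) ^ 3 := pow_le_pow_left₀ (by norm_num) (by linarith) 3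
  rw [e]; linarith [show (10 : ℝ) ≤ (5 / 2 : ℝ) ^ 3 by norm_num]

/-- The logarithm of the per-sphere constant `B = K₀ /(l⁶ t²¹⁶)`. [folklore] -/
theorem logB_ge {l t : ℕ} (hl0 : (0 : ℝ) < l) (hT : (0 : ℝ) < t) :
    -(9 / 2) - 6 * Real.log l - 216 * Real.log t ≤
      Real.log (((Real.pi * 4 / 3) ^ 2 * (2 * Real.pi) ^ (-(3 : ℝ) / 2) * (4 / 5 : ℝ) ^ 6) / ((l : ℝ) ^ 6 * (t : ℝ) ^ 216)) := by
  have hK := K0_ge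
  have hK0 : (0 : ℝ) < (Real.pi * 4 / 3) ^ 2 * (2 * Real.pi) ^ (-(3 : ℝ) / 2) * (4 / 5 : ℝ) ^ 6 := lt_of_lt_of_le (by norm_num) hK
  rw [Real.log_div hK0.ne' (by positivity), Real.log_mul (x := (l : ℝ) ^ 6) (y := (t : ℝ) ^ 216) (by positivity)
    (by positivity), Real.log_pow, Real.log_pow]
  have hK' : Real.log (Real.exp (-(9 / 2 : ℝ))) ≤
      Real.log ((Real.pi * 4 / 3) ^ 2 * (2 * Real.pi) ^ (-(3 : ℝ) / 2) * (4 / 5 : ℝ) ^ 6) :=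
    Real.log_le_log (Real.exp_pos _) (exp_neg_le.trans hK)
  rw [Real.log_exp] at hK'
  push_cast
  linarith

/-- The per-sphere budget (pure real arithmetic). [folklore] -/
theorem per_sphere {l t β a LB : ℝ} (hl2 : 2 ≤ l) (h96 : 96 ≤ t) (hβ : 0 < β) (ha : 0 ≤ a)
    (hbig : 39 * l ^ 2 * (224 + 6 * l + 40 * β * a) ≤ β * t) (hLB : -(9 / 2) - 6 * Real.log l - 216 * Real.log t ≤ LB) :
    1 < LB + β * ((9 / 350) * t ^ 2 / l ^ 2 - 40 * a / t ^ 4) - 1 - 2 := by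
  have hl0 : 0 < l := by linarith
  have hT : 0 < t := by linarith
  have h1 : 1 ≤ t := by linarith
  have hlogl : Real.log l ≤ l := (Real.log_le_sub_one_of_pos hl0).trans (by linarith)
  have hlogt : Real.log t ≤ t := (Real.log_le_sub_one_of_pos hT).trans (by linarith)
  have hW : 224 * t + 6 * l * t + 40 * β * a * t ≤ β * (9 / 350) * t ^ 2 / l ^ 2 := by
    rw [le_div_iff₀ (by positivity)]
    have := mul_le_mul_of_nonneg_right hbig hT.le
    nlinarith
  have ht4 : 40 * a / t ^ 4 ≤ 40 * a := div_le_self (by positivity) (one_le_pow₀ h1)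
  have e : β * ((9 / 350) * t ^ 2 / l ^ 2 - 40 * a / t ^ 4) = β * (9 / 350) * t ^ 2 / l ^ 2 - β * (40 * a / t ^ 4) := by ring
  rw [e]
  have hβ4 : β * (40 * a / t ^ 4) ≤ β * (40 * a) := mul_le_mul_of_nonneg_left ht4 hβ.le
  have hlt : 6 * l ≤ 6 * l * t := by nlinarith
  have ha0 : 0 ≤ 40 * β * a := by positivity
  have hat : 40 * β * a ≤ 40 * β * a * t := by nlinarith
  nlinarith

variable {l n t : ℕ} (hl : 2 ≤ l) (ht : 24 * l ^ 2 ≤ t) (hn : 2 ≤ n)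
include hl ht hn

/-- The pinning cost of the witness: `S ≤ 2 𝒩`. [folklore] -/
theorem Scost_le' : (LatW l n t).Scost ≤ 2 * ((l : ℝ) * n) ^ 3 := by
  classical
  have hn1 : 1 ≤ n := by omega
  have h1 := bpar.T1 hl ht; have hT := bpar.Tpos hl ht
  have hl0 : (0:ℝ) < l := by exact_mod_cast (show 0 < l by omega)
  have hn0 : (0:ℝ) < n := by exact_mod_cast (show 0 < n by omega)
  obtain ⟨hm1, hm2⟩ := m_bd hl ht
  have hm0 : (0:ℝ) < (LatW l n t).m := lt_of_lt_of_le (by positivity) hm1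
  have hu : (LatW l n t).P.u = (4 / 5) / (t : ℝ) ^ 40 := by rw [P_eq, Params.scale_u, bpar.u_eq]
  have hV : (LatW l n t).P.V = (t : ℝ) ^ 3 := by rw [P_eq, Params.scale_V, bpar.V_eq]
  set 𝒩 : ℝ := ((l : ℝ) * n) ^ 3 with h𝒩
  have h𝒩0 : 0 < 𝒩 := by positivity
  have hS1 := (LatW l n t).Scost_le (by rw [hV]; positivity)
  rw [card_slot] at hS1
  have hD : (((Finset.univ : Finset (LatW l n t).Slot).filter (LatW l n t).IsDriver).card : ℝ) ≤ 𝒩 / (LatW l n t).m := by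
    have h1' : (((Finset.univ : Finset (LatW l n t).Slot).filter (LatW l n t).IsDriver).card : ℝ) ≤
        (((LatW l n t).Q * ((LatW l n t).n * (LatW l n t).n) : ℕ) : ℝ) := by
      exact_mod_cast (LatW l n t).card_drivers_le
    exact h1'.trans (Qn2_le (t := t) hl hn)
  have hu1 : (4 / 5 : ℝ) / (t : ℝ) ^ 40 ≤ 1 := by
    have := bpar.small hl ht (by norm_num : 1 ≤ 40)
    have e : (4 / 5 : ℝ) / (t : ℝ) ^ 40 = (4 / 5) * (1 / (t : ℝ) ^ 40) := by ring
    linarith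
  have hpos : (0:ℝ) ≤ (4 / 5 : ℝ) / (t : ℝ) ^ 40 := by positivity
  have ht3 := bpar.T3 hl ht
  have hVu : ((LatW l n t).P.V + (LatW l n t).P.u) ^ 2 / 2 ≤ (t : ℝ) ^ 6 := by
    rw [hV, hu]; nlinarith
  have hu2 : (LatW l n t).P.u ^ 2 / 2 ≤ 1 := by rw [hu]; nlinarith
  have hDt : 𝒩 / (LatW l n t).m * (t : ℝ) ^ 6 ≤ 𝒩 := by
    rw [div_mul_eq_mul_div, div_le_iff₀ hm0]
    have hl2 : (2:ℝ) ≤ l := by exact_mod_cast hl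
    have ht6 : (0:ℝ) ≤ (t : ℝ) ^ 6 := by positivity
    have : (t : ℝ) ^ 6 ≤ 6 * (t : ℝ) ^ 7 * (l : ℝ) ^ 2 := by
      calc (t : ℝ) ^ 6 = (t : ℝ) ^ 6 * 1 * 1 := by ring
        _ ≤ (t : ℝ) ^ 6 * t * (6 * (l : ℝ) ^ 2) := by
            refine mul_le_mul (mul_le_mul_of_nonneg_left h1 ht6) (by nlinarith) zero_le_one (by positivity)
        _ = 6 * (t : ℝ) ^ 7 * (l : ℝ) ^ 2 := by ring
    nlinarith
  calc (LatW l n t).Scost ≤ _ := hS1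
    _ ≤ 𝒩 / (LatW l n t).m * (t : ℝ) ^ 6 + (((l * n) ^ 3 : ℕ) : ℝ) * 1 :=
        add_le_add (mul_le_mul hD hVu (by positivity) (by positivity)) (mul_le_mul_of_nonneg_left hu2 (by positivity))
    _ ≤ 2 * 𝒩 := by push_cast; rw [← h𝒩]; linarith

/-- **The final inequality**: `e^{N+1} < (N+1)! e^{Fmin} evB` once `β t ≥ 39 l² (224 + 6 l + 40 β |Z-1|)`.
[folklore] -/
theorem final_ineq {N : ℕ} (hN : N + 1 = (l * n) ^ 3) {β : ℝ} (hβ : 0 < β) (Z : ℝ)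
    (hbig : 39 * (l : ℝ) ^ 2 * (224 + 6 * l + 40 * β * |Z - 1|) ≤ β * t) :
    Real.exp ((N : ℝ) + 1) <
      ((N + 1).factorial : ℝ) * Real.exp ((LatW l n t).Fmin N (4 * t ^ 7 * l ^ 2) β Z) * (LatW l n t).evB N := by
  classical
  have hn1 : 1 ≤ n := by omega
  have hc := c_pos hl hn1
  have hT := bpar.Tpos hl ht; have h96 := bpar.T96 hl ht
  have hl0 : (0:ℝ) < l := by exact_mod_cast (show 0 < l by omega)
  have hn0 : (0:ℝ) < n := by exact_mod_cast (show 0 < n by omega)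
  have hl2 : (2:ℝ) ≤ l := by exact_mod_cast hl
  set Λ := LatW l n t with hΛ
  set 𝒩 : ℝ := (N : ℝ) + 1 with h𝒩
  have h𝒩eq : 𝒩 = ((l : ℝ) * n) ^ 3 := by rw [h𝒩]; exact_mod_cast hN
  have h𝒩0 : 0 < 𝒩 := by positivity
  have hcard : Fintype.card Λ.Slot = N + 1 := by rw [hΛ, card_slot, hN]
  have hr : Λ.P.r = cscale l n * ((4 / 5) / (t : ℝ) ^ 32) := by rw [hΛ, P_eq, Params.scale_r, bpar.r_eq]
  have hu : Λ.P.u = (4 / 5) / (t : ℝ) ^ 40 := by rw [hΛ, P_eq, Params.scale_u, bpar.u_eq]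
  -- the factorial and the event bound
  rw [Λ.evB_eq N, hcard]
  have hfact := Lat.pow_mul_exp_neg_le_factorial (N + 1)
  push_cast at hfact
  rw [← h𝒩] at hfact
  set A := Lat.gA Λ.P.u with hA
  have hA0 : 0 < A := by rw [hA, Lat.gA, hu]; positivity
  set R := Real.pi * 4 / 3 * Λ.P.r ^ 3 with hR
  have hR0 : 0 < R := by rw [hR, hr]; positivity
  set B := 𝒩 * R * A with hB
  have hB0 : 0 < B := by positivity
  have hBeq : B = ((Real.pi * 4 / 3) ^ 2 * (2 * Real.pi) ^ (-(3 : ℝ) / 2) * (4 / 5 : ℝ) ^ 6) / ((l : ℝ) ^ 6 * (t : ℝ) ^ 216) := by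
    rw [hB, hR, hA, Lat.gA, hr, hu, h𝒩eq, cscale]
    field_simp
  have hlogB : -(9 / 2) - 6 * Real.log l - 216 * Real.log t ≤ Real.log B := by rw [hBeq]; exact logB_ge hl0 hT
  have hS : Λ.Scost ≤ 2 * 𝒩 := by rw [h𝒩eq, hΛ]; exact Scost_le' hl ht hn
  have hF := Fmin_ge hl ht hn hN hβ.le Z
  rw [← h𝒩eq] at hF
  have hper := per_sphere hl2 h96 hβ (abs_nonneg (Z - 1)) hbig hlogB
  have hkey : 𝒩 < 𝒩 * Real.log B + Λ.Fmin N (4 * t ^ 7 * l ^ 2) β Z - 𝒩 - Λ.Scost := by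
    have := mul_lt_mul_of_pos_left hper h𝒩0
    rw [hΛ] at hS ⊢
    nlinarith
  have hpowB : B ^ (N + 1) = Real.exp (𝒩 * Real.log B) := by
    rw [h𝒩, show ((N : ℝ) + 1) = ((N + 1 : ℕ) : ℝ) by push_cast; ring, Real.exp_nat_mul, Real.exp_log hB0]
  calc Real.exp ((N : ℝ) + 1) = Real.exp 𝒩 := by rw [h𝒩]
    _ < Real.exp (𝒩 * Real.log B + Λ.Fmin N (4 * t ^ 7 * l ^ 2) β Z - 𝒩 - Λ.Scost) := Real.exp_lt_exp.2 hkey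
    _ = B ^ (N + 1) * (Real.exp (-𝒩) * Real.exp (Λ.Fmin N (4 * t ^ 7 * l ^ 2) β Z) * Real.exp (-Λ.Scost)) := by
        rw [hpowB, ← Real.exp_add, ← Real.exp_add, ← Real.exp_add]; ring_nf
    _ = (𝒩 ^ (N + 1) * Real.exp (-𝒩)) * Real.exp (Λ.Fmin N (4 * t ^ 7 * l ^ 2) β Z) *
          (R ^ (N + 1) * (A ^ (N + 1) * Real.exp (-Λ.Scost))) := by rw [hB, mul_pow, mul_pow]; ring
    _ ≤ ((N + 1).factorial : ℝ) * Real.exp (Λ.Fmin N (4 * t ^ 7 * l ^ 2) β Z) *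
          (R ^ (N + 1) * (A ^ (N + 1) * Real.exp (-Λ.Scost))) := by gcongr

end LatW

end FinalIneq

/-! ## Stage E: the witness lattice with the statement's diameter, the flow family -/

section Refutation

open MeasureTheory Literature.Analysis.FluidPDE Literature.Analysis.FunctionSpaces Literature.MathematicalPhysics.KineticTheory

/-- The witness lattice with the diameter of the statement (`ε := hsDiameter σ N` literally). -/
def LatW' (l n t : ℕ) : Lat :=
  { L := l ^ 3, n := n, m := 6 * t ^ 7 * l ^ 2 + 3,
    P := { (bpar l t).scale (cscale l n) with ε := hsDiameter ((4 / 5) / (l : ℝ) ^ 2) ((l * n) ^ 3 - 1) },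
    w := cscale l n * ((t : ℝ) ^ 4 * (l : ℝ) ^ 2) }

/-- It is the lattice analysed above. [folklore] -/
theorem LatW'_eq {l n t : ℕ} (hl : 2 ≤ l) (hn : 1 ≤ n) : LatW' l n t = LatW l n t := by
  have hN : (l * n) ^ 3 - 1 + 1 = (l * n) ^ 3 := by
    have : 1 ≤ (l * n) ^ 3 := Nat.one_le_pow _ _ (Nat.mul_pos (by omega) (by omega)); omega
  have hε := LatW.hsDiameter_eq (t := t) hl hn hN
  rw [LatW.P_eq, Params.scale_ε] at hε
  unfold LatW' LatW
  congr 1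
  simp only [Params.scale, hε]

/-- The flow family: Alexander's flows on `𝕋³` at the diameters `σ (N+1)^{-1/3} < 1/2`. [folklore] -/
def flowFam {σ : ℝ} (hσ : 0 < σ) (hσ2 : σ < 1 / 2) (N : ℕ) :
    HardSphereFlow (Torus.geometry (Fin 3)) (hsDiameter σ N) (N + 1) :=
  (HardSphereFlow.nonempty_torus_holds (hsDiameter_pos hσ N)
    (by rw [inv_eq_one_div]; exact (hsDiameter_le hσ.le N).trans_lt hσ2) (N + 1)).some

end Refutation

end EquilibriumClampedCollisionalWindowLDNegative

end Summit.AtomisticToContinuum.HydrodynamicLimit.Theorems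

end
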